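import Literature.Topology.Euclidean.LatticeCubePushSkel
import Literature.Topology.Euclidean.ConeExtension
import HarnessLib

/-!
# Cellular approximation on lattice cube complexes, I: the data, the vertices, one face

Topic `Literature/Topology/Euclidean`, continuing `LatticeCubePushSkel.lean` and
`ConeExtension.lean`. We approximate a map `e` of a finite lattice cube complex
`K = complex 𝒬 h` into itself by a **cellular** map `g` (`g` maps every closed `m`-face into the
`m`-skeleton) which stays uniformly close to `e`, following Hatcher, *Algebraic Topology* (2002),
§4.1, proof of Thm. 4.8 (induction over skeleta: extend over a cell inside a convex piece, then
push the extension off the cells of higher dimension by general position), with explicit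
control of distances so that the straight segments `[g x, e x]` stay inside `K` (needed to make
`g ≃ e` *in* `K`; this is the form used for Prop. A.11 / Cor. A.12). The hypotheses are: `e`
oscillates by at most `η` on points at distance `≤ h` of `K`, and `K` contains every lattice cube
meeting the `R`-ball around a value of `e` ("`K` is `R`-thick around `e(K)`").

This file sets up the induction:
* `LatticeCube.ApproxData 𝒬 h e n D`: a map `g`, continuous on `skel 𝒬 h n`, cellular and with
  `C¹`-covered face images on faces of dimension `≤ n`, `D`-close to `e` on `skel 𝒬 h n`;
* `LatticeCube.approxData_zero`: the start, rounding `e` to lattice corners on the vertices;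
* `LatticeCube.face_extension`: the extension over one `(n + 1)`-face (cone in the lattice box
  around `e(corner)`, then `LatticeCube.push_to_skel`), with boundary values `g ∘ param`, values
  in `skel 𝒬 h (n + 1)`, `(n + 1)`-covered image, and distance control.

The assembly of the `(n + 1)`-st stage and the final statement are in
`LatticeCubeCellularApprox.lean`. No `sorry`; [folklore] packaging of Hatcher's argument.

## References

* A. Hatcher, *Algebraic Topology*, CUP (2002), §4.1, Thm. 4.8 (cellular approximation) and
  its proof, pp. 349–351; Appendix, Prop. A.11. [HatcherAT2002]
-/

noncomputable section

open Set Metric Topology Function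

namespace Literature.Topology.Euclidean

namespace LatticeCube

variable {N : ℕ} {h : ℝ}

/-! ### Faces (from `LatticeCubeFaces.lean`): corners `Face.cornerPoint`, `Face.dist_le_of_mem_carrier`,
`Face.exists_mem_carrier_bdFace`, `Face.norm_coord_eq_one_of_not_mem_relint`,
`Face.param_mem_carrier_bdFace_of_mem_sphere` -/

/-- The `0`-skeleton of a finite cube complex is finite. [folklore] -/
theorem skel_zero_finite (𝒬 : Finset (Fin N → ℤ)) (h : ℝ) : (skel 𝒬 h 0).Finite := by
  refine ((faces_finite 𝒬).image fun F => F.cornerPoint h).subset fun x hx => ?_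
  obtain ⟨F, hF, hF0, hxF⟩ := mem_skel.1 hx
  rw [Face.carrier_eq_singleton_of_S_eq_empty (G := F) (h := h)
    (Finset.card_eq_zero.1 (Nat.le_zero.1 hF0)), mem_singleton_iff] at hxF
  exact ⟨F, hF, hxF.symm⟩

/-! ### The hypotheses and the data of the induction -/

/-- **The hypotheses of the approximation theorem**: `h > 0`, `η ≥ 0`; `e` oscillates by `≤ η`
at scale `h` on `K = complex 𝒬 h`; and `K` contains every lattice cube meeting the `R`-ball
around a value `e x`, `x ∈ K`. [folklore] -/
structure ApproxHyp (𝒬 : Finset (Fin N → ℤ)) (h : ℝ) (e : (Fin N → ℝ) → (Fin N → ℝ)) (η R : ℝ) :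
    Prop where
  hh : 0 < h
  hη : 0 ≤ η
  osc : ∀ x ∈ complex 𝒬 h, ∀ y ∈ complex 𝒬 h, dist x y ≤ h → dist (e x) (e y) ≤ η
  thick : ∀ x ∈ complex 𝒬 h, ∀ b : Fin N → ℤ,
    ((Face.top N b).carrier h ∩ closedBall (e x) R).Nonempty → b ∈ 𝒬

/-- **Stage `n` of the approximation**: a map `g`, continuous on the `n`-skeleton, mapping each
closed face of dimension `m ≤ n` into the `m`-skeleton with `m`-`C¹`-covered image, and
`D`-close to `e` on the `n`-skeleton. [folklore] -/
structure ApproxData (𝒬 : Finset (Fin N → ℤ)) (h : ℝ) (e : (Fin N → ℝ) → (Fin N → ℝ)) (n : ℕ)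
    (D : ℝ) where
  /-- the approximation on `skel 𝒬 h n` -/
  g : (Fin N → ℝ) → (Fin N → ℝ)
  continuousOn : ContinuousOn g (skel 𝒬 h n)
  mapsTo : ∀ F ∈ faces 𝒬, F.S.card ≤ n → MapsTo g (F.carrier h) (skel 𝒬 h F.S.card)
  small : ∀ F ∈ faces 𝒬, F.S.card ≤ n → IsC1Covered F.S.card (g '' F.carrier h)
  dist_le : ∀ x ∈ skel 𝒬 h n, dist (g x) (e x) ≤ D

variable {𝒬 : Finset (Fin N → ℤ)} {e : (Fin N → ℝ) → (Fin N → ℝ)} {η R : ℝ}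

/-! ### Stage `0`: round `e` to lattice corners -/

/-- The corner of the lattice cube containing a point. [folklore] -/
def roundDown (h : ℝ) (y : Fin N → ℝ) : Fin N → ℝ := fun i => (⌊y i / h⌋ : ℝ) * h

/-- Rounding down moves by at most `h` (sup distance). [folklore] -/
theorem dist_roundDown_le (hh : 0 < h) (y : Fin N → ℝ) : dist (roundDown h y) y ≤ h := by
  rw [dist_pi_le_iff hh.le]
  intro i
  rw [Real.dist_eq, abs_le]
  have h1 : ((⌊y i / h⌋ : ℤ) : ℝ) ≤ y i / h := Int.floor_le _
  have h2 : y i / h < (⌊y i / h⌋ : ℝ) + 1 := Int.lt_floor_add_one _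
  rw [le_div_iff₀ hh] at h1
  rw [div_lt_iff₀ hh] at h2
  simp only [roundDown]
  constructor <;> linarith

/-- **Stage `0`** (Hatcher 2002, proof of Thm. 4.8, start of the induction: the `0`-cells): on
the vertices take `g x =` the corner of the lattice cube containing `e x`; it is a vertex of the
complex by thickness (`R ≥ 0`), and `h`-close to `e x`. [cite: HatcherAT2002, Thm. 4.8 (proof)] -/
theorem approxData_zero (H : ApproxHyp 𝒬 h e η R) (hR : 0 ≤ R) :
    Nonempty (ApproxData 𝒬 h e 0 h) := by
  refine ⟨⟨fun x => roundDown h (e x), (skel_zero_finite 𝒬 h).continuousOn _, ?_, ?_, ?_⟩⟩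
  · intro F hF hF0 x hx
    have hF0' : F.S.card = 0 := Nat.le_zero.1 hF0
    rw [hF0']
    -- the cube `b` containing `e x` belongs to `𝒬`, and `roundDown (e x)` is its corner vertex
    have hxK : x ∈ complex 𝒬 h := carrier_subset_complex H.hh.le hF hx
    set b : Fin N → ℤ := fun i => ⌊e x i / h⌋ with hb
    have hb𝒬 : b ∈ 𝒬 := H.thick x hxK b ⟨e x, mem_carrier_top_floor H.hh (e x),
      mem_closedBall_self hR⟩
    refine mem_skel.2 ⟨⟨b, ∅⟩, ⟨b, hb𝒬, fun i => ⟨fun hi => absurd hi (by simp), fun _ => Or.inl rfl⟩⟩,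
      by simp, ?_⟩
    intro i
    exact ⟨fun hi => absurd hi (by simp), fun _ => rfl⟩
  · intro F hF hF0
    have hF0' : F.S = ∅ := Finset.card_eq_zero.1 (Nat.le_zero.1 hF0)
    rw [Face.carrier_eq_singleton_of_S_eq_empty (G := F) (h := h) hF0', image_singleton]
    exact isC1Covered_of_finite (Set.finite_singleton _)
  · intro x _
    exact dist_roundDown_le H.hh (e x)

/-! ### The extension over one `(n + 1)`-face -/

/-- **Extension over one face** (Hatcher 2002, proof of Thm. 4.8: extend over the cell, then
push off the higher-dimensional cells; here with distance control). Given stage `n` and an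
`(n + 1)`-face `F` of the complex (`n + 1 ≤ N`), with `Dₙ + η + h ≤ R`: there is
`Φ : [-1, 1]ⁿ⁺¹ → skel 𝒬 h (n + 1)`, continuous, with `(n + 1)`-covered image, equal to
`g ∘ param_F` on the boundary sphere, and `(Dₙ + η + h)`-close to `e(corner F)`.
[cite: HatcherAT2002, Thm. 4.8 (proof)] -/
theorem face_extension (H : ApproxHyp 𝒬 h e η R) {n : ℕ} {D : ℝ} (hD : 0 ≤ D)
    (A : ApproxData 𝒬 h e n D) (hn : n + 1 ≤ N) (hR : D + η + h ≤ R) {F : Face N}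
    (hF : F ∈ faces 𝒬) (hFn : F.S.card = n + 1) :
    ∃ Φ : (Fin (n + 1) → ℝ) → (Fin N → ℝ), ContinuousOn Φ (closedBall 0 1) ∧
      MapsTo Φ (closedBall 0 1) (skel 𝒬 h (n + 1)) ∧ IsC1Covered (n + 1) (Φ '' closedBall 0 1) ∧
      (∀ w ∈ sphere (0 : Fin (n + 1) → ℝ) 1, Φ w = A.g (F.param h hFn w)) ∧
      (∀ w ∈ closedBall (0 : Fin (n + 1) → ℝ) 1, dist (Φ w) (e (F.cornerPoint h)) ≤ D + η + h) := by
  have hh := H.hh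
  set c : Fin N → ℝ := e (F.cornerPoint h) with hc
  set ρ : ℝ := D + η with hρ
  have hρ0 : 0 ≤ ρ := add_nonneg hD H.hη
  have hcornK : F.cornerPoint h ∈ complex 𝒬 h := carrier_subset_complex hh.le hF (Face.cornerPoint_mem_carrier (G := F) hh.le)
  -- the lattice box around `closedBall c ρ` lies in the complex
  set lo := boxLo c ρ h with hlo
  set hi := boxHi c ρ h with hhi
  have hlt : ∀ i, lo i < hi i := boxLo_lt_boxHi hh hρ0
  have hBK : box lo hi h ⊆ complex 𝒬 h :=
    boxAround_subset_complex hh c hρ0 fun b hb => H.thick _ hcornK b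
      (hb.mono (inter_subset_inter_right _ (closedBall_subset_closedBall (by linarith))))
  -- the boundary values
  set φ : (Fin (n + 1) → ℝ) → (Fin N → ℝ) := fun w => A.g (F.param h hFn w) with hφ
  have hps : ∀ w ∈ sphere (0 : Fin (n + 1) → ℝ) 1, F.param h hFn w ∈ skel 𝒬 h n := by
    intro w hw
    obtain ⟨i₀, hi₀, b, hjb⟩ := F.param_mem_carrier_bdFace_of_mem_sphere hh hFn hw
    refine carrier_subset_skel (bdFace_mem_faces hF hi₀ b) ?_ hjb
    rw [Face.card_bdFace_S hi₀, hFn]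
    omega
  have hφc : ContinuousOn φ (sphere 0 1) :=
    A.continuousOn.comp Face.continuous_param.continuousOn hps
  have hφball : ∀ w ∈ sphere (0 : Fin (n + 1) → ℝ) 1, φ w ∈ closedBall c ρ := by
    intro w hw
    have hy : F.param h hFn w ∈ F.carrier h := Face.param_mem_carrier hh w
    have hyK : F.param h hFn w ∈ complex 𝒬 h := carrier_subset_complex hh.le hF hy
    rw [mem_closedBall]
    calc dist (φ w) c ≤ dist (φ w) (e (F.param h hFn w)) + dist (e (F.param h hFn w)) c :=
          dist_triangle _ _ _
      _ ≤ D + η := add_le_add (A.dist_le _ (hps w hw))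
          (H.osc _ hyK _ hcornK (Face.dist_le_of_mem_carrier (G := F) hh.le hy
            (Face.cornerPoint_mem_carrier (G := F) hh.le)))
  -- the cone extension, with values in the box
  set Φ₀ := coneExt c φ with hΦ₀
  have hΦ₀c : ContinuousOn Φ₀ (closedBall 0 1) := continuousOn_coneExt c hφc
  have hΦ₀B : MapsTo Φ₀ (closedBall 0 1) (box lo hi h) := fun w hw =>
    coneExt_mem_of_convex (convex_box lo hi h) (closedBall_subset_box hh c ρ
      (mem_closedBall_self hρ0)) (fun w hw => closedBall_subset_box hh c ρ (hφball w hw)) hw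
  have hΦ₀s : IsC1Covered (n + 1) (Φ₀ '' closedBall 0 1) := by
    refine isC1Covered_image_coneExt c ?_
    -- `φ(sphere) ⊆ ⋃ g(boundary faces)`, each `n`-covered by stage `n`
    refine (isC1Covered_iUnion (J := ↥F.S × Bool) (A := fun ib =>
      A.g '' (F.bdFace (ib.1 : Fin N) ib.2).carrier h) fun ib => ?_).mono ?_
    · have h1 := A.small _ (bdFace_mem_faces hF ib.1.2 ib.2) (by
        rw [Face.card_bdFace_S ib.1.2, hFn]; omega)
      rwa [Face.card_bdFace_S ib.1.2, hFn, Nat.add_sub_cancel] at h1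
    · rintro _ ⟨w, hw, rfl⟩
      obtain ⟨i₀, hi₀, b, hjb⟩ := F.param_mem_carrier_bdFace_of_mem_sphere hh hFn hw
      exact mem_iUnion.2 ⟨(⟨i₀, hi₀⟩, b), _, hjb, rfl⟩
  -- push into the `(n + 1)`-skeleton
  have hNskel : skel 𝒬 h N = complex 𝒬 h := skel_eq_complex hh.le le_rfl
  let P₀ : PushData 𝒬 h (n + 1) N (closedBall (0 : Fin (n + 1) → ℝ) 1) Φ₀ :=
    { Φ := Φ₀
      continuousOn := hΦ₀c
      mapsTo := fun w hw => by rw [hNskel]; exact hBK (hΦ₀B hw)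
      small := hΦ₀s
      agree := fun _ _ _ => rfl
      box := fun _ _ _ _ _ hb => hb }
  obtain ⟨P⟩ := push_to_skel hh N hn P₀
  refine ⟨P.Φ, P.continuousOn, P.mapsTo, P.small, fun w hw => ?_, fun w hw => ?_⟩
  · have h1 : Φ₀ w ∈ skel 𝒬 h (n + 1) := by
      rw [hΦ₀, coneExt_of_mem_sphere c φ hw]
      obtain ⟨i₀, hi₀, b, hjb⟩ := F.param_mem_carrier_bdFace_of_mem_sphere hh hFn hw
      have hcard : (F.bdFace i₀ b).S.card = n := by
        rw [Face.card_bdFace_S hi₀, hFn]; omega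
      have h2 := A.mapsTo _ (bdFace_mem_faces hF hi₀ b) hcard.le hjb
      rw [hcard] at h2
      exact skel_mono (Nat.le_succ n) h2
    rw [P.agree w (sphere_subset_closedBall hw) h1, hΦ₀, coneExt_of_mem_sphere c φ hw]
  · have h1 : P.Φ w ∈ box lo hi h := P.box w hw lo hi hlt (hΦ₀B hw)
    have h2 := box_subset_closedBall hh c hρ0 h1
    rw [mem_closedBall] at h2
    linarith

end LatticeCube

end Literature.Topology.Euclidean

end
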